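import Summits.KontsevichZagierPeriods.KontsevichZagierPeriods.Theorems.TerasomaMultiplicationBetaCancellationWeightDescent
import Summits.KontsevichZagierPeriods.KontsevichZagierPeriods.Theorems.TerasomaMultiplicationBetaCancellationRegionDescent
import Summits.KontsevichZagierPeriods.KontsevichZagierPeriods.Theorems.TerasomaMultiplicationBetaCancellationStubWeight2Exists
import Summits.KontsevichZagierPeriods.KontsevichZagierPeriods.Theorems.TerasomaMultiplicationBetaCancellationStubWeight2Mul
import Summits.KontsevichZagierPeriods.KontsevichZagierPeriods.Theorems.TerasomaMultiplicationBetaCancellationStubWeight2Lift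
import Summits.KontsevichZagierPeriods.KontsevichZagierPeriods.Theorems.TerasomaMultiplicationBetaCancellationStubPiMulPair
import Summits.KontsevichZagierPeriods.KontsevichZagierPeriods.Theorems.TerasomaMultiplicationBetaCancellationStubWeight2Const

/-!
# Weight descent in BOTH disc coordinates — the final form of the multiplier method

Crux lead seat c9, cycle 3 (`--supports` stmt-KontsevichZagierPeriods-13633, line `dirichlet-companion-to-pi`).
`…WeightDescent.lean` (p125576) descends certificates along the multiplier `M_w [t, f] = [t, w(z 0)·f]`
for a weight of the FIRST disc coordinate, with Newton–Leibniz over bases of dimension `≥ 1`. A family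
of integrand multipliers commuting with Newton–Leibniz over bases of dimension `≥ k` can depend on the
first `k` coordinates only, and the lift to the pinned disc family forces `k ≤ 2`: the FINAL FORM of
the method is a bounded `ℚ`-semialgebraic weight `h(z 0, z 1)` of both disc coordinates with
Newton–Leibniz over bases of dimension `≥ 2` (both disc coordinates are base coordinates). It contains
region descent (`…RegionDescent.lean`, `h = 𝟙_T`) and 1-D weight descent restricted to NL `≥ 2`.

* `stub_piMulPair` — the strongest lift: `lift (of ∘ P)` maps `relations` into the closure of
  additivity, the DOUBLY FIBRED substitutions (`Ψ x 0 = x 0 ∧ Ψ x 1 = x 1`) and Newton–Leibniz over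
  bases `≥ 2`; hence `[π]·relations` is `h`-preserving for every `h`;
* `weight2Descent` — MASTER THEOREM: if `[D, h(x,y)]` finishes then `π`-cancellation holds for every
  certificate in the closure of additivity, `h`-preserving substitutions of `(n+2)`-dimensional
  representations (`h (Φ x 0) (Φ x 1) = h (x 0) (x 1)`), and Newton–Leibniz over bases `≥ 2`;
  `ayoubPiCancellation_iff_weight2Reduction`;
* showcase `h₂(x, y) = w₁(x) + w₁(y)`, `w₁(u) = (1 + u)√(1 − u²)₊`, `[D, h₂] = 16/3` (integrand
  additivity + the coordinate swap + `stub_weightConst` twice): `weight2_ayoubPiCancellation`, whose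
  compatible substitutions move `(z 0, z 1)` along the genuinely two-dimensional level curves of `h₂`.
-/

noncomputable section

-- `Summit.KontsevichZagierPeriods.KontsevichZagierPeriods.…` is the tree's mandated layout (single-conjunct summit).
set_option linter.dupNamespace false

namespace Summit.KontsevichZagierPeriods.KontsevichZagierPeriods.BetaCancellationLine

open Set
open Literature.NumberTheory.Transcendental
open Literature.NumberTheory.Transcendental.KZ
open Summit.KontsevichZagierPeriods.KontsevichZagierPeriods.BetaCancellationNegative
  (scale_mem_relations_iff)

/-! ## Registered stubs — all five delegated stubs are tree theorems (wave 3, seat c9)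

`stub_weight2Exists` (p126164), `stub_weight2Mul` (p126397), `stub_weight2Lift` (p126166), `stub_piMulPair`
(p126178), `stub_weight2Const` (p126286) — files `…StubWeight2Exists/StubWeight2Mul/StubWeight2Lift/StubPiMulPair/
StubWeight2Const.lean`, imported above. -/

/-! ## Assembly -/


/-- **A two-coordinate multiplier exists** (free extension of a choice of companions; kills dimensions
`0` and `1`). [folklore] -/
theorem exists_weight2Mul (h : ℝ → ℝ → ℝ)
    (hex : ∀ (k : ℕ) (r : IntegralRep (k + 2)),
      ∃ s : IntegralRep (k + 2), s.domain = r.domain ∧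
        s.integrand = fun z => h (z 0) (z 1) * r.integrand z) :
    ∃ M : FormalRep →+ FormalRep,
      (∀ r : IntegralRep 0, M (of r) = 0) ∧ (∀ r : IntegralRep 1, M (of r) = 0) ∧
      (∀ (k : ℕ) (r s : IntegralRep (k + 2)), s.domain = r.domain →
          (s.integrand = fun z => h (z 0) (z 1) * r.integrand z) → M (of r) = of s) := by
  classical
  refine ⟨FreeAbelianGroup.lift (fun s : (Σ n, IntegralRep n) => match s with
      | ⟨0, _⟩ => 0
      | ⟨1, _⟩ => 0
      | ⟨k + 2, r⟩ => of (Classical.choose (hex k r))), ?_, ?_, ?_⟩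
  · intro r
    show FreeAbelianGroup.lift _ (FreeAbelianGroup.of _) = 0
    rw [FreeAbelianGroup.lift_apply_of]
  · intro r
    show FreeAbelianGroup.lift _ (FreeAbelianGroup.of _) = 0
    rw [FreeAbelianGroup.lift_apply_of]
  · intro k r s hd hi
    show FreeAbelianGroup.lift _ (FreeAbelianGroup.of _) = of s
    rw [FreeAbelianGroup.lift_apply_of]
    obtain ⟨hd', hi'⟩ := Classical.choose_spec (hex k r)
    exact congrArg of (IntegralRep.ext' (hd'.trans hd.symm) (hi'.trans hi.symm))

/-- The `h`-preserving generators (two coordinates) are relations, so their closure is `≤ relations`.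
[folklore] -/
theorem weight2Closure_le_relations (h : ℝ → ℝ → ℝ) :
    AddSubgroup.closure (domainAddRel ∪ integrandAddRel ∪
          {x | ∃ (n : ℕ) (r r' : IntegralRep (n + 2)) (Φ : (Fin (n + 2) → ℝ) → (Fin (n + 2) → ℝ))
              (Φ' : (Fin (n + 2) → ℝ) → (Fin (n + 2) → ℝ) →L[ℝ] (Fin (n + 2) → ℝ)),
            IsSemialgebraicMapOn ℚ r.domain Φ ∧
            (∀ x ∈ r.domain, HasFDerivWithinAt Φ (Φ' x) r.domain x) ∧ Set.InjOn Φ r.domain ∧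
            r'.domain = Φ '' r.domain ∧
            (∀ x ∈ r.domain, r.integrand x = r'.integrand (Φ x) * |(Φ' x).det|) ∧
            (∀ x ∈ r.domain, h (Φ x 0) (Φ x 1) = h (x 0) (x 1)) ∧
            x = of r - of r'} ∪
          {x | x ∈ newtonLeibnizRel ∧ ∃ (n : ℕ) (r : IntegralRep (n + 3)) (r' : IntegralRep (n + 2)),
            x = of r - of r'}) ≤ relations := by
  refine (AddSubgroup.closure_le relations).mpr ?_
  rintro y (((hy | hy) | hy) | hy)
  · exact domainAddRel_subset_relations hy
  · exact integrandAddRel_subset_relations hy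
  · obtain ⟨k, r, r', Φ, Φ', hΦ, hΦ', hinj, hdom, hf, -, rfl⟩ := hy
    exact changeOfVariablesRel_subset_relations ⟨k + 2, r, r', Φ, Φ', hΦ, hΦ', hinj, hdom, hf, rfl⟩
  · exact newtonLeibnizRel_subset_relations hy.1

/-- **WEIGHT DESCENT IN TWO COORDINATES (final form of the multiplier method).** Let `h` be a bounded
`ℚ`-semialgebraic weight of two real variables and `D_h = [D, h(x,y)]` the weighted disc. If `D_h`
FINISHES then `π`-cancellation (item 0540) holds for every pinned disc family `P` and every certificate
`lift (of ∘ P) c` in the closure of additivity, the `h`-preserving substitutions and Newton–Leibniz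
over bases of dimension `≥ 2`. Region descent (seat c8) is the case `h = 𝟙_T`. [folklore] -/
theorem weight2Descent :
    ∀ (h : ℝ → ℝ → ℝ), IsSemialgebraicFunOn ℚ (Set.univ : Set (Fin 2 → ℝ)) (fun x => h (x 0) (x 1)) →
    ∀ (B : ℝ), (∀ u v : ℝ, |h u v| ≤ B) →
    ∀ {Dh : IntegralRep 2}, Dh.domain = piDisc → (Dh.integrand = fun z => h (z 0) (z 1)) →
    (∀ c : FormalRep, of Dh * c ∈ relations → of piRep * c ∈ relations → c ∈ relations) →
    ∀ (P : ∀ n : ℕ, IntegralRep n → IntegralRep (n + 2)),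
      (∀ (n : ℕ) (r : IntegralRep n), (P n r).domain = {z : Fin (n + 2) → ℝ | z 0 ^ 2 + z 1 ^ 2 ≤ 1 ∧ (fun i : Fin n => z i.succ.succ) ∈ r.domain} ∧ (P n r).integrand = fun z => r.integrand (fun i : Fin n => z i.succ.succ)) →
      ∀ (c : FormalRep),
        FreeAbelianGroup.lift (fun s : (Σ n, IntegralRep n) => of (P s.1 s.2)) c ∈
          AddSubgroup.closure (domainAddRel ∪ integrandAddRel ∪
          {x | ∃ (n : ℕ) (r r' : IntegralRep (n + 2)) (Φ : (Fin (n + 2) → ℝ) → (Fin (n + 2) → ℝ))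
              (Φ' : (Fin (n + 2) → ℝ) → (Fin (n + 2) → ℝ) →L[ℝ] (Fin (n + 2) → ℝ)),
            IsSemialgebraicMapOn ℚ r.domain Φ ∧
            (∀ x ∈ r.domain, HasFDerivWithinAt Φ (Φ' x) r.domain x) ∧ Set.InjOn Φ r.domain ∧
            r'.domain = Φ '' r.domain ∧
            (∀ x ∈ r.domain, r.integrand x = r'.integrand (Φ x) * |(Φ' x).det|) ∧
            (∀ x ∈ r.domain, h (Φ x 0) (Φ x 1) = h (x 0) (x 1)) ∧
            x = of r - of r'} ∪
          {x | x ∈ newtonLeibnizRel ∧ ∃ (n : ℕ) (r : IntegralRep (n + 3)) (r' : IntegralRep (n + 2)),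
            x = of r - of r'}) →
        c ∈ relations := by
  intro h hh B hB Dh hDh hDh1 hfin P hP c hc
  have hex := stub_weight2Exists h hh B hB
  obtain ⟨M, h0, h1, hpin⟩ := exists_weight2Mul h hex
  have hM := stub_weight2Mul h hh hex M h0 h1 hpin _ hc
  have hL := stub_weight2Lift h hex P hP Dh hDh hDh1 M hpin c
  have hS : of Dh * c ∈ relations := by
    simpa using relations.add_mem hL hM
  have hπ : of piRep * c ∈ relations := by
    have h3 := piRep_mul_sub_lift_mem_relations P hP c
    have h4 := weight2Closure_le_relations h hc
    simpa using relations.add_mem h3 h4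
  exact hfin c hS hπ

/-- **Disc multiples of relations are `h`-preserving relations for EVERY two-coordinate weight `h`**
(`stub_piMulPair`: doubly fibred substitutions preserve `h (z 0) (z 1)`). [folklore] -/
theorem piMul_mem_weight2Closure (h : ℝ → ℝ → ℝ)
    (P : ∀ n : ℕ, IntegralRep n → IntegralRep (n + 2))
    (hP : ∀ (n : ℕ) (r : IntegralRep n),
      (P n r).domain = {z : Fin (n + 2) → ℝ | z 0 ^ 2 + z 1 ^ 2 ≤ 1 ∧ (fun i : Fin n => z i.succ.succ) ∈ r.domain} ∧
      (P n r).integrand = fun z => r.integrand (fun i : Fin n => z i.succ.succ))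
    (c : FormalRep) (hc : c ∈ relations) :
    FreeAbelianGroup.lift (fun s : (Σ n, IntegralRep n) => of (P s.1 s.2)) c ∈
          AddSubgroup.closure (domainAddRel ∪ integrandAddRel ∪
          {x | ∃ (n : ℕ) (r r' : IntegralRep (n + 2)) (Φ : (Fin (n + 2) → ℝ) → (Fin (n + 2) → ℝ))
              (Φ' : (Fin (n + 2) → ℝ) → (Fin (n + 2) → ℝ) →L[ℝ] (Fin (n + 2) → ℝ)),
            IsSemialgebraicMapOn ℚ r.domain Φ ∧
            (∀ x ∈ r.domain, HasFDerivWithinAt Φ (Φ' x) r.domain x) ∧ Set.InjOn Φ r.domain ∧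
            r'.domain = Φ '' r.domain ∧
            (∀ x ∈ r.domain, r.integrand x = r'.integrand (Φ x) * |(Φ' x).det|) ∧
            (∀ x ∈ r.domain, h (Φ x 0) (Φ x 1) = h (x 0) (x 1)) ∧
            x = of r - of r'} ∪
          {x | x ∈ newtonLeibnizRel ∧ ∃ (n : ℕ) (r : IntegralRep (n + 3)) (r' : IntegralRep (n + 2)),
            x = of r - of r'}) := by
  refine AddSubgroup.closure_mono ?_ (stub_piMulPair P hP c hc)
  rintro y (((hy | hy) | hy) | hy)
  · exact Or.inl (Or.inl (Or.inl hy))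
  · exact Or.inl (Or.inl (Or.inr hy))
  · obtain ⟨k, r, r', Φ, Φ', hΦ, hΦ', hinj, hdom, hf, h01, rfl⟩ := hy
    exact Or.inl (Or.inr ⟨k, r, r', Φ, Φ', hΦ, hΦ', hinj, hdom, hf,
      fun x hx => by rw [(h01 x hx).1, (h01 x hx).2], rfl⟩)
  · exact Or.inr hy

/-- **Item 0540 ⟺ two-coordinate `h`-REDUCTION, for every finishing weight `h`.** [folklore] -/
theorem ayoubPiCancellation_iff_weight2Reduction
    (h : ℝ → ℝ → ℝ) (hh : IsSemialgebraicFunOn ℚ (Set.univ : Set (Fin 2 → ℝ)) (fun x => h (x 0) (x 1)))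
    (B : ℝ) (hB : ∀ u v : ℝ, |h u v| ≤ B)
    {Dh : IntegralRep 2} (hDh : Dh.domain = piDisc) (hDh1 : Dh.integrand = fun z => h (z 0) (z 1))
    (hfin : ∀ c : FormalRep, of Dh * c ∈ relations → of piRep * c ∈ relations → c ∈ relations) :
    Summit.KontsevichZagierPeriods.KontsevichZagierPeriods.Theses.AyoubSpecialisation.AyoubPiCancellation ↔
    ∀ (P : ∀ n : ℕ, IntegralRep n → IntegralRep (n + 2)),
      (∀ (n : ℕ) (r : IntegralRep n), (P n r).domain = {z : Fin (n + 2) → ℝ | z 0 ^ 2 + z 1 ^ 2 ≤ 1 ∧ (fun i : Fin n => z i.succ.succ) ∈ r.domain} ∧ (P n r).integrand = fun z => r.integrand (fun i : Fin n => z i.succ.succ)) →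
      ∀ c : FormalRep,
        FreeAbelianGroup.lift (fun s : (Σ n, IntegralRep n) => of (P s.1 s.2)) c ∈ relations →
        FreeAbelianGroup.lift (fun s : (Σ n, IntegralRep n) => of (P s.1 s.2)) c ∈
          AddSubgroup.closure (domainAddRel ∪ integrandAddRel ∪
          {x | ∃ (n : ℕ) (r r' : IntegralRep (n + 2)) (Φ : (Fin (n + 2) → ℝ) → (Fin (n + 2) → ℝ))
              (Φ' : (Fin (n + 2) → ℝ) → (Fin (n + 2) → ℝ) →L[ℝ] (Fin (n + 2) → ℝ)),
            IsSemialgebraicMapOn ℚ r.domain Φ ∧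
            (∀ x ∈ r.domain, HasFDerivWithinAt Φ (Φ' x) r.domain x) ∧ Set.InjOn Φ r.domain ∧
            r'.domain = Φ '' r.domain ∧
            (∀ x ∈ r.domain, r.integrand x = r'.integrand (Φ x) * |(Φ' x).det|) ∧
            (∀ x ∈ r.domain, h (Φ x 0) (Φ x 1) = h (x 0) (x 1)) ∧
            x = of r - of r'} ∪
          {x | x ∈ newtonLeibnizRel ∧ ∃ (n : ℕ) (r : IntegralRep (n + 3)) (r' : IntegralRep (n + 2)),
            x = of r - of r'}) := by
  constructor
  · intro hA P hP c hc
    exact piMul_mem_weight2Closure h P hP c (hA P hP c hc)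
  · intro hA P hP c hc
    exact weight2Descent h hh B hB hDh hDh1 hfin P hP c (hA P hP c hc)

/-- **`π`-CANCELLATION FOR `h₂`-PRESERVING CERTIFICATES** (`h₂(x,y) = w₁(x) + w₁(y)`; UNCONDITIONAL — the
five delegated stubs are tree theorems): `[D, h₂]` is worth `16/3 ≠ 0` against any factor, so it finishes.
[folklore] -/
theorem weight2_ayoubPiCancellation :
    ∀ (P : ∀ n : ℕ, IntegralRep n → IntegralRep (n + 2)),
      (∀ (n : ℕ) (r : IntegralRep n), (P n r).domain = {z : Fin (n + 2) → ℝ | z 0 ^ 2 + z 1 ^ 2 ≤ 1 ∧ (fun i : Fin n => z i.succ.succ) ∈ r.domain} ∧ (P n r).integrand = fun z => r.integrand (fun i : Fin n => z i.succ.succ)) →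
      ∀ c : FormalRep,
        FreeAbelianGroup.lift (fun s : (Σ n, IntegralRep n) => of (P s.1 s.2)) c ∈
          AddSubgroup.closure (domainAddRel ∪ integrandAddRel ∪
          {x | ∃ (n : ℕ) (r r' : IntegralRep (n + 2)) (Φ : (Fin (n + 2) → ℝ) → (Fin (n + 2) → ℝ))
              (Φ' : (Fin (n + 2) → ℝ) → (Fin (n + 2) → ℝ) →L[ℝ] (Fin (n + 2) → ℝ)),
            IsSemialgebraicMapOn ℚ r.domain Φ ∧
            (∀ x ∈ r.domain, HasFDerivWithinAt Φ (Φ' x) r.domain x) ∧ Set.InjOn Φ r.domain ∧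
            r'.domain = Φ '' r.domain ∧
            (∀ x ∈ r.domain, r.integrand x = r'.integrand (Φ x) * |(Φ' x).det|) ∧
            (∀ x ∈ r.domain,
              (1 + Φ x 0) * Real.sqrt (1 - Φ x 0 ^ 2) + (1 + Φ x 1) * Real.sqrt (1 - Φ x 1 ^ 2) =
              (1 + x 0) * Real.sqrt (1 - x 0 ^ 2) + (1 + x 1) * Real.sqrt (1 - x 1 ^ 2)) ∧
            x = of r - of r'} ∪
          {x | x ∈ newtonLeibnizRel ∧ ∃ (n : ℕ) (r : IntegralRep (n + 3)) (r' : IntegralRep (n + 2)),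
            x = of r - of r'}) →
        c ∈ relations := by
  obtain ⟨hsa, hbd, Dh, hDh, hDh1, hDhc⟩ := stub_weight2Const
  have h163 : IsAlgebraic ℚ (16 / 3 : ℝ) := by
    have hq := isAlgebraic_algebraMap (R := ℚ) (A := ℝ) (16 / 3 : ℚ)
    have e : (algebraMap ℚ ℝ) (16 / 3 : ℚ) = (16 / 3 : ℝ) := by
      rw [eq_ratCast]; push_cast; ring
    rwa [e] at hq
  have hfin : ∀ c : FormalRep, of Dh * c ∈ relations → of piRep * c ∈ relations → c ∈ relations :=
    fun c hc _ => mem_relations_of_of_mul_mem_of_forall_prod_equivalent Dh h163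
      (by norm_num) (hDhc h163) c hc
  exact weight2Descent (fun u v : ℝ => (1 + u) * Real.sqrt (1 - u ^ 2) + (1 + v) * Real.sqrt (1 - v ^ 2))
    hsa 4 hbd hDh hDh1 hfin

/-- **Item 0540 ⟺ `h₂`-REDUCTION** (two-coordinate weight `h₂(x,y) = w₁(x) + w₁(y)`). [folklore] -/
theorem ayoubPiCancellation_iff_weight2Reduction_h₂ :
    Summit.KontsevichZagierPeriods.KontsevichZagierPeriods.Theses.AyoubSpecialisation.AyoubPiCancellation ↔
    ∀ (P : ∀ n : ℕ, IntegralRep n → IntegralRep (n + 2)),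
      (∀ (n : ℕ) (r : IntegralRep n), (P n r).domain = {z : Fin (n + 2) → ℝ | z 0 ^ 2 + z 1 ^ 2 ≤ 1 ∧ (fun i : Fin n => z i.succ.succ) ∈ r.domain} ∧ (P n r).integrand = fun z => r.integrand (fun i : Fin n => z i.succ.succ)) →
      ∀ c : FormalRep,
        FreeAbelianGroup.lift (fun s : (Σ n, IntegralRep n) => of (P s.1 s.2)) c ∈ relations →
        FreeAbelianGroup.lift (fun s : (Σ n, IntegralRep n) => of (P s.1 s.2)) c ∈
          AddSubgroup.closure (domainAddRel ∪ integrandAddRel ∪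
          {x | ∃ (n : ℕ) (r r' : IntegralRep (n + 2)) (Φ : (Fin (n + 2) → ℝ) → (Fin (n + 2) → ℝ))
              (Φ' : (Fin (n + 2) → ℝ) → (Fin (n + 2) → ℝ) →L[ℝ] (Fin (n + 2) → ℝ)),
            IsSemialgebraicMapOn ℚ r.domain Φ ∧
            (∀ x ∈ r.domain, HasFDerivWithinAt Φ (Φ' x) r.domain x) ∧ Set.InjOn Φ r.domain ∧
            r'.domain = Φ '' r.domain ∧
            (∀ x ∈ r.domain, r.integrand x = r'.integrand (Φ x) * |(Φ' x).det|) ∧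
            (∀ x ∈ r.domain,
              (1 + Φ x 0) * Real.sqrt (1 - Φ x 0 ^ 2) + (1 + Φ x 1) * Real.sqrt (1 - Φ x 1 ^ 2) =
              (1 + x 0) * Real.sqrt (1 - x 0 ^ 2) + (1 + x 1) * Real.sqrt (1 - x 1 ^ 2)) ∧
            x = of r - of r'} ∪
          {x | x ∈ newtonLeibnizRel ∧ ∃ (n : ℕ) (r : IntegralRep (n + 3)) (r' : IntegralRep (n + 2)),
            x = of r - of r'}) := by
  constructor
  · intro hA P hP c hc
    exact piMul_mem_weight2Closure
      (fun u v : ℝ => (1 + u) * Real.sqrt (1 - u ^ 2) + (1 + v) * Real.sqrt (1 - v ^ 2)) P hP c (hA P hP c hc)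
  · intro hA P hP c hc
    exact weight2_ayoubPiCancellation P hP c (hA P hP c hc)

/-- **THE CRUX ⟺ `h₂`-REDUCTION**: `BetaCancellation` (stmt-13633) holds iff every relation among disc
multiples can be re-certified with substitutions preserving `w₁(x) + w₁(y)` and Newton–Leibniz over
bases of dimension `≥ 2` (≡ item 0540). [folklore] -/
theorem betaCancellation_iff_weight2Reduction :
    Summit.KontsevichZagierPeriods.KontsevichZagierPeriods.Theses.TerasomaMultiplication.BetaCancellation ↔
    ∀ (P : ∀ n : ℕ, IntegralRep n → IntegralRep (n + 2)),
      (∀ (n : ℕ) (r : IntegralRep n), (P n r).domain = {z : Fin (n + 2) → ℝ | z 0 ^ 2 + z 1 ^ 2 ≤ 1 ∧ (fun i : Fin n => z i.succ.succ) ∈ r.domain} ∧ (P n r).integrand = fun z => r.integrand (fun i : Fin n => z i.succ.succ)) →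
      ∀ c : FormalRep,
        FreeAbelianGroup.lift (fun s : (Σ n, IntegralRep n) => of (P s.1 s.2)) c ∈ relations →
        FreeAbelianGroup.lift (fun s : (Σ n, IntegralRep n) => of (P s.1 s.2)) c ∈
          AddSubgroup.closure (domainAddRel ∪ integrandAddRel ∪
          {x | ∃ (n : ℕ) (r r' : IntegralRep (n + 2)) (Φ : (Fin (n + 2) → ℝ) → (Fin (n + 2) → ℝ))
              (Φ' : (Fin (n + 2) → ℝ) → (Fin (n + 2) → ℝ) →L[ℝ] (Fin (n + 2) → ℝ)),
            IsSemialgebraicMapOn ℚ r.domain Φ ∧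
            (∀ x ∈ r.domain, HasFDerivWithinAt Φ (Φ' x) r.domain x) ∧ Set.InjOn Φ r.domain ∧
            r'.domain = Φ '' r.domain ∧
            (∀ x ∈ r.domain, r.integrand x = r'.integrand (Φ x) * |(Φ' x).det|) ∧
            (∀ x ∈ r.domain,
              (1 + Φ x 0) * Real.sqrt (1 - Φ x 0 ^ 2) + (1 + Φ x 1) * Real.sqrt (1 - Φ x 1 ^ 2) =
              (1 + x 0) * Real.sqrt (1 - x 0 ^ 2) + (1 + x 1) * Real.sqrt (1 - x 1 ^ 2)) ∧
            x = of r - of r'} ∪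
          {x | x ∈ newtonLeibnizRel ∧ ∃ (n : ℕ) (r : IntegralRep (n + 3)) (r' : IntegralRep (n + 2)),
            x = of r - of r'}) :=
  betaCancellation_iff_ayoubPiCancellation.trans ayoubPiCancellation_iff_weight2Reduction_h₂

end Summit.KontsevichZagierPeriods.KontsevichZagierPeriods.BetaCancellationLine
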